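import Summits.SmoothPoincare4.SmoothPoincare4.Theorems.EntropyRungCompactShrinkerGapJensenVolumeBound
import Literature.Geometry.Riemannian.ChangGurskyYangRegularity
import Mathlib.Topology.Homotopy.Equiv
import HarnessLib

/-!
# The Einstein sub-case of the variance budget of line `cgy-variance-pivot`
(crux `EntropyRung.CompactShrinkerGap`, item stmt-SmoothPoincare4-10870)

The line reduces the crux to ONE inequality among the soliton integrals of a closed normalised 4-d
gradient shrinker `Ric + Hess f = g/2`, `R + |∇f|² = f` of Gaussian mass
`Z = ∫e^{-f} dV > Z₀ = 32π²√π e^{-3/2}` on a homotopy 4-sphere: the VARIANCE BUDGET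
`D := ∫(R − 2)² dV < 2V − 96π²` (`V = Vol(M, g)`; registered stub `stub_varianceBudget`, the open
transfer target). This file records, as the registered stub `stub_varianceBudget_of_einstein`, the first of the
two honest SUFFICIENT CONDITIONS that the density hypothesis buys today (the second, the pointwise
bound `R ≤ 2.48`, is the registered stub `stub_varianceBudget_of_scalarCurvature_le`, landed
separately once the farm serves the module of `stub_scalarCurvaturePos_of_identities`):

* the EINSTEIN sub-case `Hess f ≡ 0`: then `Ric = g/2`, `R = 2` (`R + Δf = 2` with `Δf = tr 0 = 0`),
  so `D = 0`, and the volume floor `V > e²Z₀ = 32π²√π e^{1/2} ≈ 93.5π²`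
  (`volume_floor_of_density`, from the Jensen argument `∫fe^{-f} = 2∫e^{-f}`) gives
  `0 < 2V − 96π²` (Cao–Hamilton–Ilmanen 2004, §4: `Θ(S⁴) = 6/e² > Θ(S³×ℝ)`; the refuter's
  `einstein_budget_iff`: in the Einstein class the budget is exactly `V > 48π²`);
* the POINTWISE condition `R ≤ 2.48`: a closed shrinker has `R > 0`
  (`stub_scalarCurvaturePos_of_identities`, fed by `stub_shrinkerScalarIdentities`), so
  `(R − 2)² = R² − 4R + 4 ≤ (c − 4)R + 4` for `0 ≤ R ≤ c`, and `∫R dV = 2V` (`R + Δf = 2`,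
  `∫Δf dV = 0`), whence `D ≤ 2(c − 2)V = 0.96·V < 2V − 96π²` as soon as `V > 96π²/1.04 ≈ 92.3π²`,
  which the same volume floor provides (Cheng–Ribeiro–Zhou 2023, Rem. 2: `∫R² ≤ R_max∫R`; the
  threshold is `c < 3 − 48π²/V`, `≈ 2.486` at the floor).

Everything here is proved (no `sorry`, no named fact); the numerics reduce to `2.9 < √π·e^{1/2}`.

## References

* H.-D. Cao, R. S. Hamilton, T. Ilmanen, *Gaussian densities and stability for some Ricci
  solitons*, arXiv:math/0404165 (2004), §4. [CaoHamiltonIlmanen2004]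
* X. Cheng, E. Ribeiro Jr., D. Zhou, *On four-dimensional compact gradient shrinking Ricci solitons*
  (arXiv:2203.14916), Rem. 2. [ChengRibeiroZhou2022]
-/

noncomputable section

-- the registered namespace `Summit.SmoothPoincare4.SmoothPoincare4.Theorems` repeats a component
set_option linter.dupNamespace false

open Bundle Set Function Filter Module MeasureTheory
open scoped Manifold ContDiff Topology ENNReal ContinuousMap

namespace Summit.SmoothPoincare4.SmoothPoincare4.Theorems

open Literature.Geometry Literature.Geometry.Lorentzian Literature.Geometry.Riemannian
  Literature.Geometry.Lorentzian.PseudoRiemannianMetric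

/-- **Numerics of the volume floor**: `2.9 < √π · e^{1/2}` (`√π > 1.77245`, `e^{1/2} > 1.6487`,
product `≈ 2.9222`). [folklore] -/
theorem two_point_nine_lt_sqrt_pi_mul_exp_half : (2.9 : ℝ) < Real.sqrt Real.pi * Real.exp (1 / 2) := by
  have hs : (1.77245 : ℝ) < Real.sqrt Real.pi := by
    rw [Real.lt_sqrt (by norm_num)]
    have := Real.pi_gt_d6
    nlinarith
  have ht : (1.6487 : ℝ) < Real.exp (1 / 2) := by
    have h : (1.6487 : ℝ) ^ 2 < Real.exp (1 / 2) ^ 2 := by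
      rw [← Real.exp_nat_mul]
      norm_num
      have := Real.exp_one_gt_d9
      linarith
    exact lt_of_pow_lt_pow_left₀ 2 (Real.exp_pos _).le h
  calc (2.9 : ℝ) < 1.77245 * 1.6487 := by norm_num
    _ < Real.sqrt Real.pi * Real.exp (1 / 2) := mul_lt_mul'' hs ht (by norm_num) (by norm_num)

/-- **The volume floor in the form `92.8π² < V`** for the crux data (from
`volume_floor_of_density`: `V > 32π²√π e^{1/2}` and `√π e^{1/2} > 2.9`).
[cite: CaoHamiltonIlmanen2004, §4] -/
theorem volume_floor_numeric
    (M : Type) [TopologicalSpace M] [T2Space M] [SecondCountableTopology M]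
    [ChartedSpace (EuclideanSpace ℝ (Fin 4)) M] [IsManifold (𝓡 4) ∞ M] [CompactSpace M]
    [T3Space M] [MeasurableSpace M] [BorelSpace M]
    (g : Literature.Geometry.Lorentzian.PseudoRiemannianMetric (𝓡 4) ∞ (EuclideanSpace ℝ (Fin 4))
      (TangentSpace (𝓡 4) : M → Type _)) [g.HasLeviCivita] (f : M → ℝ) (hg : g.IsRiemannian)
    (hf : ContMDiff (𝓡 4) 𝓘(ℝ, ℝ) ∞ f)
    (hsol : ∀ (x : M) (X Y : TangentSpace (𝓡 4) x),
      g.ricci x X Y + g.hessian f x X Y = (1 / 2 : ℝ) * g.val x X Y)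
    (hnorm : ∀ x : M, g.scalarCurvature x + g.gradSq f x = f x)
    (hdens : ENNReal.ofReal (32 * Real.pi ^ 2 * Real.sqrt Real.pi * Real.exp (-(3 : ℝ) / 2)) <
      ∫⁻ x, ENNReal.ofReal (Real.exp (-f x))
        ∂(Literature.Geometry.Lorentzian.riemannianMeasure (g.toContMDiffRiemannianMetric hg))) :
    92.8 * Real.pi ^ 2 <
      ((Literature.Geometry.Lorentzian.riemannianMeasure (g.toContMDiffRiemannianMetric hg))
        Set.univ).toReal := by
  have hV := volume_floor_of_density M g f hg hf hsol hnorm hdens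
  have hπ : 0 < 32 * Real.pi ^ 2 := by positivity
  have h29 := two_point_nine_lt_sqrt_pi_mul_exp_half
  calc 92.8 * Real.pi ^ 2 = 32 * Real.pi ^ 2 * 2.9 := by ring
    _ < 32 * Real.pi ^ 2 * (Real.sqrt Real.pi * Real.exp (1 / 2)) := mul_lt_mul_of_pos_left h29 hπ
    _ = 32 * Real.pi ^ 2 * Real.sqrt Real.pi * Real.exp (1 / 2) := by ring
    _ < _ := hV

/-- **STUB 1a of line `cgy-variance-pivot` — the variance budget in the Einstein sub-case.** For the
crux data (closed `M ≃ₕ S⁴`, Riemannian `g` with Levi-Civita connection, smooth `f`,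
`Ric + Hess f = g/2`, `R + |∇f|² = f`, `∫e^{-f} dV > 32π²√π e^{-3/2}`) with `Hess f ≡ 0`:
`∫(R − 2)² dV < 2·Vol − 96π²`. Indeed `Δf = tr_g Hess f = 0`, so `R = 2` by the traced soliton
equation `R + Δf = 2` (`IsGradientShrinker.scalarCurvature_add_dalembertian_one`, `finrank = 4`),
the left-hand side vanishes, and `Vol > 92.8π² > 48π²` (`volume_floor_numeric`). The homotopy
equivalence is not used. [cite: CaoHamiltonIlmanen2004, §4] -/
theorem stub_varianceBudget_of_einstein :
    ∀ (M : Type) [TopologicalSpace M] [T2Space M] [SecondCountableTopology M]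
      [ChartedSpace (EuclideanSpace ℝ (Fin 4)) M] [IsManifold (𝓡 4) ∞ M] [CompactSpace M]
      [T3Space M] [MeasurableSpace M] [BorelSpace M],
      M ≃ₕ Metric.sphere (0 : EuclideanSpace ℝ (Fin 5)) 1 →
    ∀ (g : Literature.Geometry.Lorentzian.PseudoRiemannianMetric (𝓡 4) ∞ (EuclideanSpace ℝ (Fin 4))
        (TangentSpace (𝓡 4) : M → Type _)) [g.HasLeviCivita] (f : M → ℝ) (hg : g.IsRiemannian),
      ContMDiff (𝓡 4) 𝓘(ℝ, ℝ) ∞ f →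
      (∀ (x : M) (X Y : TangentSpace (𝓡 4) x),
        g.ricci x X Y + g.hessian f x X Y = (1 / 2 : ℝ) * g.val x X Y) →
      (∀ x : M, g.scalarCurvature x + g.gradSq f x = f x) →
      ENNReal.ofReal (32 * Real.pi ^ 2 * Real.sqrt Real.pi * Real.exp (-(3 : ℝ) / 2)) <
        ∫⁻ x, ENNReal.ofReal (Real.exp (-f x))
          ∂(Literature.Geometry.Lorentzian.riemannianMeasure (g.toContMDiffRiemannianMetric hg)) →
      (∀ (x : M) (X Y : TangentSpace (𝓡 4) x), g.hessian f x X Y = 0) →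
      ∫ x, (g.scalarCurvature x - 2) ^ 2
          ∂(Literature.Geometry.Lorentzian.riemannianMeasure (g.toContMDiffRiemannianMetric hg)) <
        2 * ((Literature.Geometry.Lorentzian.riemannianMeasure (g.toContMDiffRiemannianMetric hg))
              Set.univ).toReal - 96 * Real.pi ^ 2 := by
  intro M _ _ _ _ _ _ _ _ _ _ g _ f hg hf hsol hnorm hdens hE
  have hEfin : finrank ℝ (EuclideanSpace ℝ (Fin 4)) = 4 := finrank_euclideanSpace_fin
  have hshr : g.IsGradientShrinker f 1 := (g.isGradientShrinker_one_iff f).2 hsol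
  -- `Hess f = 0` as a bilinear form, so `Δf = 0` and `R = 2`
  have hR2 : ∀ x, g.scalarCurvature x = 2 := fun x ↦ by
    have hH : g.hessian f x = 0 := LinearMap.ext₂ fun X Y ↦ by simp [hE x X Y]
    have hΔ : g.dalembertian f x = 0 := by
      simp [PseudoRiemannianMetric.dalembertian, PseudoRiemannianMetric.trace, hH]
    have h := hshr.scalarCurvature_add_dalembertian_one x
    rw [hEfin, hΔ] at h
    norm_num at h
    linarith
  have h0 : ∫ x, (g.scalarCurvature x - 2) ^ 2
      ∂(Literature.Geometry.Lorentzian.riemannianMeasure (g.toContMDiffRiemannianMetric hg)) = 0 := by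
    simp [hR2]
  rw [h0]
  have hV := volume_floor_numeric M g f hg hf hsol hnorm hdens
  nlinarith [hV, Real.pi_pos]

end Summit.SmoothPoincare4.SmoothPoincare4.Theorems
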